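import Literature.Geometry.Lorentzian.KerrSchild
import Literature.Geometry.Lorentzian.ChartCalculus
import Literature.Geometry.Lorentzian.KerrHyperboloidalLeaves
import HarnessLib

/-!
# `KerrShieldedSettles`, line `tapered-temporal-collar` — stub S6a `stub_kerrExteriorDecomposition`, part A

Generic facts about **time-shift maps** `Φ(x) = x + φ(x)•∂₀` of `E4` (the shape of both late-time
charts of the lead's `N = 1` decomposition of the Kerr chart — the receding-bend hole chart and the bent
flat chart): derivative `id + dφ ⊗ ∂₀`, invertibility when `1 + ∂₀φ ≠ 0`, the local-homeomorphism
property (inverse function theorem), injectivity from monotonicity along the time fibres, and adapters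
turning these into `ContMDiff` / `mfderiv` / `IsOpenEmbedding` statements for maps between open subsets
of `E4` (the Kerr chart `Kerr.region a r₁` and the model domains are `TopologicalSpace.Opens E4`).
References: Lee, *Introduction to Smooth Manifolds*, Thm. 4.5, Prop. 3.9.
-/

set_option linter.dupNamespace false

noncomputable section

open Set Filter Topology
open scoped Manifold ContDiff Topology ENNReal
open Literature.Geometry.Lorentzian

namespace Summit.FinalStateConjecture.FinalStateConjecture.Theorems.SwallowTheDatum.KerrShieldedSettles

namespace ExteriorDecomposition


/-! ## The derivative of a time shift and its inverse -/

/-- The time shift `x ↦ x + φ(x)•∂₀` has derivative `v ↦ v + dφ(v)•∂₀`. [folklore] -/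
theorem hasFDerivAt_timeShift {φ : E4 → ℝ} {φ' : E4 →L[ℝ] ℝ} {x : E4} (h : HasFDerivAt φ φ' x) :
    HasFDerivAt (fun y : E4 ↦ y + φ y • E4.basisVector 0)
      (ContinuousLinearMap.id ℝ E4 + φ'.smulRight (E4.basisVector 0)) x :=
  (hasFDerivAt_id x).add (h.smul_const _)

/-- The strict version of `hasFDerivAt_timeShift` for a `C¹` shift. [folklore] -/
theorem hasStrictFDerivAt_timeShift {φ : E4 → ℝ} {x : E4} {n : WithTop ℕ∞}
    (h : ContDiffAt ℝ n φ x) (hn : n ≠ 0) :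
    HasStrictFDerivAt (fun y : E4 ↦ y + φ y • E4.basisVector 0)
      (ContinuousLinearMap.id ℝ E4 + (fderiv ℝ φ x).smulRight (E4.basisVector 0)) x :=
  (hasStrictFDerivAt_id x).add ((h.hasStrictFDerivAt hn).smul_const _)

/-- The rank-one perturbation `v ↦ v + α(v)•∂₀` of the identity is invertible as soon as
`1 + α(∂₀) ≠ 0` (inverse `w ↦ w − (α w / (1 + α ∂₀))•∂₀`). [folklore] -/
theorem exists_equiv_timeShift (α : E4 →L[ℝ] ℝ) (hα : 1 + α (E4.basisVector 0) ≠ 0) :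
    ∃ L : E4 ≃L[ℝ] E4,
      (L : E4 →L[ℝ] E4) = ContinuousLinearMap.id ℝ E4 + α.smulRight (E4.basisVector 0) := by
  set e : E4 := E4.basisVector 0
  set A : E4 →L[ℝ] E4 := ContinuousLinearMap.id ℝ E4 + α.smulRight e
  set B : E4 →L[ℝ] E4 :=
    ContinuousLinearMap.id ℝ E4 - ((1 + α e)⁻¹ • α).smulRight e
  have hA : ∀ v, A v = v + α v • e := fun v ↦ rfl
  have hB : ∀ w, B w = w - ((1 + α e)⁻¹ * α w) • e := fun w ↦ rfl
  have h1 : Function.LeftInverse B A := by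
    intro v
    have key : α v - (1 + α e)⁻¹ * (α v + α v * α e) = 0 := by
      field_simp
      ring
    calc B (A v) = v + (α v - (1 + α e)⁻¹ * (α v + α v * α e)) • e := by
          rw [hB, hA, map_add, map_smul, smul_eq_mul]
          module
      _ = v := by rw [key, zero_smul, add_zero]
  have h2 : Function.RightInverse B A := by
    intro w
    have key : α w - (1 + α e)⁻¹ * α w * α e - (1 + α e)⁻¹ * α w = 0 := by
      field_simp
      ring
    calc A (B w) = w + (α w - (1 + α e)⁻¹ * α w * α e - (1 + α e)⁻¹ * α w) • e := by
          rw [hA, hB, map_sub, map_smul, smul_eq_mul]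
          module
      _ = w := by rw [key, zero_smul, add_zero]
  exact ⟨ContinuousLinearEquiv.equivOfInverse A B h1 h2, rfl⟩

/-- **Inverse function theorem for time shifts**: a `C¹` time shift with `1 + ∂₀φ(x) ≠ 0` maps
neighbourhoods of `x` onto neighbourhoods of its image. [folklore] -/
theorem map_nhds_timeShift {φ : E4 → ℝ} {x : E4} {n : WithTop ℕ∞} (h : ContDiffAt ℝ n φ x)
    (hn : n ≠ 0) (hx : 1 + fderiv ℝ φ x (E4.basisVector 0) ≠ 0) :
    map (fun y : E4 ↦ y + φ y • E4.basisVector 0) (𝓝 x) = 𝓝 (x + φ x • E4.basisVector 0) := by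
  obtain ⟨L, hL⟩ := exists_equiv_timeShift (fderiv ℝ φ x) hx
  have hs := hasStrictFDerivAt_timeShift h hn
  rw [← hL] at hs
  exact hs.map_nhds_eq_of_equiv

/-- A time shift which is strictly increasing along the time fibres of `U` is injective on `U`
(it does not move the spatial part). [folklore] -/
theorem injOn_timeShift {U : Set E4} {φ : E4 → ℝ}
    (hmono : ∀ x ∈ U, ∀ y ∈ U, E4.spatial x = E4.spatial y → x 0 < y 0 → x 0 + φ x < y 0 + φ y) :
    InjOn (fun y : E4 ↦ y + φ y • E4.basisVector 0) U := by
  intro x hx y hy hxy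
  have hsp : E4.spatial x = E4.spatial y := by
    have := congrArg E4.spatial hxy
    simpa [map_add, map_smul, E4.spatial_basisVector_zero] using this
  have ht : x 0 + φ x = y 0 + φ y := by
    have := congrArg (fun z : E4 ↦ z 0) hxy
    simpa using this
  rcases lt_trichotomy (x 0) (y 0) with hlt | heq | hgt
  · exact absurd ht (ne_of_lt (hmono x hx y hy hsp hlt))
  · calc x = E4.ofTimeSpace (x 0) (E4.spatial x) := (E4.ofTimeSpace_time_spatial x).symm
      _ = E4.ofTimeSpace (y 0) (E4.spatial y) := by rw [heq, hsp]
      _ = y := E4.ofTimeSpace_time_spatial y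
  · exact absurd ht.symm (ne_of_lt (hmono y hy x hx hsp.symm hgt))

/-! ## Adapters: maps between open subsets of `E4` -/

section Adapters

variable {U W : TopologicalSpace.Opens E4}

/-- A map between open subsets of `E4` with a representative that is `C^n` at every point is
`C^n` in the manifold sense. [folklore] -/
theorem contMDiff_of_repr (Ψ : U → W) (Φ : E4 → E4) (hΦ : ∀ y : U, (Ψ y : E4) = Φ y)
    {n : WithTop ℕ∞} (hc : ∀ y : U, ContDiffAt ℝ n Φ y) : ContMDiff 𝓘(ℝ, E4) 𝓘(ℝ, E4) n Ψ := by
  intro y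
  have h1 : ContMDiffAt 𝓘(ℝ, E4) 𝓘(ℝ, E4) n (fun z : U ↦ (Ψ z : E4)) y :=
    (OpensChart.contMDiffAt_iff y (fun z : U ↦ (Ψ z : E4)) Φ hΦ).2 (hc y)
  exact (ChartedSpace.liftPropWithinAt_subtypeVal_comp_iff Ψ Set.univ y).mp h1

/-- The manifold derivative of a map between open subsets of `E4` is the Fréchet derivative of a
representative. [folklore] -/
theorem mfderiv_of_repr (Ψ : U → W) (Φ : E4 → E4) (hΦ : ∀ y : U, (Ψ y : E4) = Φ y) (y : U)
    (hd : DifferentiableAt ℝ Φ y) :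
    mfderiv 𝓘(ℝ, E4) 𝓘(ℝ, E4) Ψ y = fderiv ℝ Φ y := by
  have h1 : mfderiv 𝓘(ℝ, E4) 𝓘(ℝ, E4) (fun z : U ↦ (Ψ z : E4)) y = fderiv ℝ Φ y :=
    OpensChart.mfderiv_eq y _ Φ hΦ hd
  have hdm : MDifferentiableAt 𝓘(ℝ, E4) 𝓘(ℝ, E4) (fun z : U ↦ (Ψ z : E4)) y :=
    (OpensChart.mdifferentiableAt_iff y _ Φ hΦ).2 hd
  rw [← h1]
  exact OpensChart.mfderiv_codRestrict (fun _ ↦ rfl) hdm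

/-- **Open-embedding adapter.** Let `Ψ : U → W` be continuous with representative `Φ` on the
subset `V ⊆ U`, open in `U`; if `Φ` is injective on `Subtype.val '' V` and maps neighbourhoods of
each point of `V` onto neighbourhoods of the image, then `Ψ|_V` is an open embedding. [folklore] -/
theorem isOpenEmbedding_restrict_of_repr (Ψ : U → W) (Φ : E4 → E4) {V : Set U} (hV : IsOpen V)
    (hΦ : ∀ y ∈ V, (Ψ y : E4) = Φ y) (hcont : Continuous Ψ)
    (hinj : InjOn Φ (Subtype.val '' V))
    (hnhds : ∀ y ∈ V, map Φ (𝓝 (y : E4)) = 𝓝 (Φ y)) :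
    IsOpenEmbedding (V.restrict Ψ) := by
  refine IsOpenEmbedding.of_continuous_injective_isOpenMap
    (hcont.comp continuous_subtype_val) ?_ ?_
  · rintro ⟨y, hy⟩ ⟨y', hy'⟩ h
    have h' : Φ y = Φ y' := by
      have := congrArg (fun z : W ↦ (z : E4)) h
      simpa [Set.restrict_apply, hΦ y hy, hΦ y' hy'] using this
    have := hinj ⟨y, hy, rfl⟩ ⟨y', hy', rfl⟩ h'
    exact Subtype.ext (Subtype.ext this)
  · rw [isOpenMap_iff_nhds_le]
    rintro ⟨y, hy⟩
    -- neighbourhoods in the nested subtype `V` and in `W` are computed through `Subtype.val`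
    have hvalU : map (Subtype.val : U → E4) (𝓝 y) = 𝓝 (y : E4) :=
      U.2.isOpenEmbedding_subtypeVal.map_nhds_eq y
    have hvalV : map (Subtype.val : V → U) (𝓝 (⟨y, hy⟩ : V)) = 𝓝 y :=
      hV.isOpenEmbedding_subtypeVal.map_nhds_eq ⟨y, hy⟩
    have hcomp : (Subtype.val : W → E4) ∘ V.restrict Ψ =
        Φ ∘ (Subtype.val : U → E4) ∘ (Subtype.val : V → U) := by
      funext z; exact hΦ z.1 z.2
    have key : map (Subtype.val : W → E4) (map (V.restrict Ψ) (𝓝 (⟨y, hy⟩ : V))) =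
        𝓝 (Φ y) := by
      rw [Filter.map_map, hcomp, ← Filter.map_map, ← Filter.map_map, hvalV, hvalU]
      exact hnhds y hy
    have hΨy : (V.restrict Ψ ⟨y, hy⟩ : E4) = Φ y := hΦ y hy
    calc 𝓝 (V.restrict Ψ ⟨y, hy⟩)
        = comap (Subtype.val : W → E4) (𝓝 (V.restrict Ψ ⟨y, hy⟩ : E4)) := nhds_subtype _ _
      _ = comap (Subtype.val : W → E4)
            (map (Subtype.val : W → E4) (map (V.restrict Ψ) (𝓝 (⟨y, hy⟩ : V)))) := by
          rw [key, hΨy]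
      _ = map (V.restrict Ψ) (𝓝 (⟨y, hy⟩ : V)) := comap_map Subtype.val_injective
      _ ≤ map (V.restrict Ψ) (𝓝 (⟨y, hy⟩ : V)) := le_rfl

end Adapters


/-- **Registered helper stub** (line `tapered-temporal-collar`, S6a part A): the open-embedding adapter
`isOpenEmbedding_restrict_of_repr` for maps between open subsets of `E4`. [folklore] -/
theorem _root_.Summit.FinalStateConjecture.FinalStateConjecture.Theorems.SwallowTheDatum.KerrShieldedSettles.stub_kerrExteriorDecompositionAdapters :
    ∀ {U W : TopologicalSpace.Opens E4} (Ψ : U → W) (Φ : E4 → E4) {V : Set U}, IsOpen V →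
      (∀ y ∈ V, (Ψ y : E4) = Φ y) → Continuous Ψ → Set.InjOn Φ (Subtype.val '' V) →
      (∀ y ∈ V, Filter.map Φ (nhds (y : E4)) = nhds (Φ y)) → Topology.IsOpenEmbedding (V.restrict Ψ) :=
  fun Ψ Φ _ hV hΦ hcont hinj hnhds ↦ isOpenEmbedding_restrict_of_repr Ψ Φ hV hΦ hcont hinj hnhds

end ExteriorDecomposition

end Summit.FinalStateConjecture.FinalStateConjecture.Theorems.SwallowTheDatum.KerrShieldedSettles

end
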